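import Mathlib
import Literature.Algebra.Polynomial.ParriloCopositiveSos
import Literature.Algebra.Polynomial.PolyaPositivstellensatz
import Literature.Combinatorics.Optimization.MotzkinStrausCopositive
import HarnessLib

/-!
# The de Klerk–Pasechnik semidefinite bounds `ϑ^{(r)}(G)` for the stability number

De Klerk and Pasechnik [cite: DeklerkPasechnik2002, §4] approximate the copositive formulation
`α(G) = min {t : t(I + A_G) - J ∈ COP_n}` (`MotzkinStrausCopositive.isCopositive_dkpMatrix_iff`)
from the inside by Parrilo's cones: the LP cones `C^{(r)}_n` (`MotzkinStrausCopositive.InPolyaCone`,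
parameters `ζ^{(r)}(G)` = `MotzkinStrausCopositive.zeta`) and the SDP cones `K^{(r)}_n`
(`ParriloCopositiveSos.InParriloCone`: `(∑ᵢ xᵢ²)^r · ∑_{ij} M_{ij} xᵢ² xⱼ²` is a sum of squares),
giving `ϑ^{(r)}(G) = inf {t : t(I + A_G) - J ∈ K^{(r)}_n}` [cite: LaurentVargas2022, §1]
[cite: Gvozdenovic2008, (4.37)] [cite: Laurent2008, Example 3.24]. This file connects the two
in-tree anchors and records the basic theory of the parameters `ϑ^{(r)}(G)` (`theta G r`).

## Main statements

* **Reznick's theorem for even forms, via Pólya** (`isSumSq_sumSq_pow_mul_sqLift`,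
  `exists_isSumSq_sumSq_pow_mul_sqLift`) [cite: Laurent2008, Thm 3.22 (even forms) and Thm 3.21]:
  if a form `f` is positive on the standard simplex then `(∑ xᵢ²)^r f(x₁², …, xₙ²)` is a sum of
  squares for all large `r` — with the explicit Powers–Reznick threshold
  `λ(r + d) > L·d(d-1)/2` of the in-tree `PolyaPositivstellensatz.polya_powersReznick`
  (the polynomial `(∑ xᵢ)^r f` then has nonnegative coefficients, and even lifts of such polynomials
  are sums of squares, `ParriloCopositiveSos.isSumSq_sqLift_of_coeff_nonneg`).
* **Cone inclusions** `C^{(r)}_n ⊆ K^{(r)}_n` (`inParriloCone_of_inPolyaCone`), strict copositivity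
  `⇒ K^{(r)}`-membership with the LP rate (`inParriloCone_of_strict`) and
  `int(COP_n) ⊆ ⋃_r K^{(r)}_n` (`exists_inParriloCone_of_pos`) [cite: Gvozdenovic2008, §4.2.1]
  [cite: LaurentVargas2022, §1]; `K^{(r)}_n + K^{(r)}_n ⊆ K^{(r)}_n` (`inParriloCone_add`).
* **The hierarchy `ϑ^{(r)}(G)`** (`theta`): every level is feasible — a cover of `V` by `k` cliques
  gives the order-0 certificate `k(I + A_G) - J = (k·[C i = C j] - J) + k(I + A_G - [C i = C j])
  ∈ PSD_n + N_n = K^{(0)}_n` (`inParriloCone_zero_dkpMatrix_of_colorable`, Cauchy–Schwarz over the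
  blocks; singletons: `inParriloCone_dkpMatrix_card`); feasibility is up-closed in `t`
  (`inParriloCone_dkpMatrix_mono`, `inParriloCone_dkpMatrix_of_theta_lt`);
  `α(G) ≤ ϑ^{(r)}(G) ≤ ζ^{(r)}(G)` (`indepNum_le_theta`, `theta_le_zeta`, the latter for the levels
  `r ≥ α(G) - 1` where `ζ^{(r)}` is finite), `ϑ^{(r)}(G) ≤ n` (`theta_le_card`),
  `ϑ^{(r)}(G) ≤ χ(Ḡ)`-type bounds from clique covers (`theta_le_of_colorable`), monotonicity
  `ϑ^{(r+1)} ≤ ϑ^{(r)}` (`theta_anti`) [cite: LaurentVargas2022, §1 ("α(G) ≤ ϑ^{(r)}(G) ≤ ζ^{(r)}(G)")]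
  [cite: Gvozdenovic2008, §4.2.1].
* **Finite convergence after rounding** (`floor_theta_eq_indepNum`) [cite: Gvozdenovic2008, Thm 4.2.10]
  [cite: DeklerkPasechnik2002, §4]: `⌊ϑ^{(r)}(G)⌋ = α(G)` for `r ≥ α(G)² - 1`, through the in-tree
  LP fact `MotzkinStrausCopositive.floor_zeta_eq_indepNum`.
* **`ϑ`-rank zero** (`theta_eq_indepNum_of_colorable`) [cite: LaurentVargas2022, §1]: if `V` is
  covered by `α(G)` cliques (`α(G) = χ(Ḡ)`, e.g. perfect graphs) then `ϑ^{(r)}(G) = α(G)` for all `r`.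
* **The 5-cycle at order 0** (`not_inParriloCone_zero_dkpMatrix_cycleGraph_five`)
  [cite: Laurent2008, Example 3.23] [cite: LaurentVargas2022, §1 ("C_5 has … ϑ-rank 1")]:
  `2(I + A_{C₅}) - J` (the Horn matrix, `-1` exactly on the pentagram) is not in
  `K^{(0)}_5 = PSD_5 + N_5` — the certificate of order 0 fails at `t = α(C₅) = 2`
  (a PSD matrix with unit diagonal and entries `≤ -1` along an odd cycle cannot exist).

## Not treated

Attainment of the infimum `ϑ^{(r)}(G)` (closedness of `K^{(r)}_n`), the identification
`ϑ^{(0)}(G) = ϑ'(G)` (Schrijver's parameter) and the exact values `ϑ^{(0)}(C₅) = √5`,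
`ϑ^{(1)}(C₅) = 2`; de Klerk–Pasechnik's conjecture `ϑ^{(α(G)-1)}(G) = α(G)` and the
Laurent–Vargas results towards it are statements about these infima and are only quoted here.
-/

noncomputable section

namespace Literature.Combinatorics.Optimization.DeKlerkPasechnikTheta

open MvPolynomial Matrix Finset
open Literature.Algebra.Polynomial.ParriloCopositiveSos
open Literature.Combinatorics.Optimization.MotzkinStrausCopositive

variable {V : Type*} [Fintype V]

/-! ## Reznick's theorem for even forms, via Pólya -/

section EvenForms

omit [Fintype V] in
/-- `x₁ + ⋯ + xₙ` is a linear form. [folklore] -/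
@[folklore] private theorem isHomogeneous_sumX (s : Finset V) :
    (∑ i ∈ s, X i : MvPolynomial V ℝ).IsHomogeneous 1 :=
  IsHomogeneous.sum _ _ _ fun i _ => isHomogeneous_X ℝ i

/-- Under the Pólya–Powers–Reznick hypotheses *every* coefficient of `(∑ xᵢ)^N · f` is `≥ 0`
(the ones of the wrong degree vanish). [folklore] -/
@[folklore] private theorem coeff_sumX_pow_mul_nonneg (f : MvPolynomial V ℝ) {d : ℕ}
    (hf : f.IsHomogeneous d) {L lam : ℝ} (hL : ∀ α : V →₀ ℕ, |coeff α f| ≤ L * (α.multinomial : ℝ))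
    (hpos : ∀ x ∈ stdSimplex ℝ V, lam ≤ eval x f) {N : ℕ}
    (hN : L * (d.choose 2 : ℝ) < lam * (N + d : ℝ)) (m : V →₀ ℕ) :
    0 ≤ coeff m ((∑ i, X i : MvPolynomial V ℝ) ^ N * f) := by
  classical
  by_cases hm : m.degree = N + d
  · exact (Literature.Algebra.Polynomial.polya_powersReznick f hf hL hpos hN m hm).le
  · have hhom : ((∑ i, X i : MvPolynomial V ℝ) ^ N * f).IsHomogeneous (N + d) := by
      have := ((isHomogeneous_sumX (Finset.univ : Finset V)).pow N).mul hf
      rwa [one_mul] at this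
    rw [hhom.coeff_eq_zero hm]

/-- **Reznick's theorem for even forms, with the Powers–Reznick bound** [cite: Laurent2008, Thm 3.22
(the case of even forms `P = p(x^{∘2})`) via Thm 3.21 (Pólya)] [cite: PowersReznick2001, Thm 1]:
let `f` be a form of degree `d` with `|f_α| ≤ L·d!/α!` and `f ≥ λ` on the standard simplex; if
`λ (N + d) > L · d(d-1)/2` then `(∑ᵢ xᵢ²)^N · f(x₁², …, xₙ²)` is a sum of squares of polynomials
(indeed `(∑ xᵢ)^N f` has nonnegative coefficients, and even lifts of such polynomials are SOS). -/
theorem isSumSq_sumSq_pow_mul_sqLift (f : MvPolynomial V ℝ) {d : ℕ} (hf : f.IsHomogeneous d)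
    {L lam : ℝ} (hL : ∀ α : V →₀ ℕ, |coeff α f| ≤ L * (α.multinomial : ℝ))
    (hpos : ∀ x ∈ stdSimplex ℝ V, lam ≤ eval x f) {N : ℕ}
    (hN : L * (d.choose 2 : ℝ) < lam * (N + d : ℝ)) :
    IsSumSq ((∑ i, X i ^ 2 : MvPolynomial V ℝ) ^ N * sqLift f) := by
  have := isSumSq_sqLift_of_coeff_nonneg _ (coeff_sumX_pow_mul_nonneg f hf hL hpos hN)
  rw [map_mul, map_pow, map_sum] at this
  simp only [sqLift_X] at this
  exact this

/-- **Reznick's theorem for even forms** [cite: Laurent2008, Thm 3.22 (for `P = p(x^{∘2})`; proved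
here through Pólya's theorem, Thm 3.21)]: if the form `f` is positive on the standard simplex
(equivalently: the even form `f(x^{∘2})` is positive definite), then `(∑ᵢ xᵢ²)^r · f(x^{∘2})` is a
sum of squares for all large `r`. -/
theorem exists_isSumSq_sumSq_pow_mul_sqLift (f : MvPolynomial V ℝ) {d : ℕ} (hf : f.IsHomogeneous d)
    (hpos : ∀ x ∈ stdSimplex ℝ V, 0 < eval x f) :
    ∃ r₀ : ℕ, ∀ r : ℕ, r₀ ≤ r → IsSumSq ((∑ i, X i ^ 2 : MvPolynomial V ℝ) ^ r * sqLift f) := by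
  classical
  obtain ⟨N₀, hN₀⟩ := Literature.Algebra.Polynomial.polya f hf hpos
  refine ⟨N₀, fun r hr => ?_⟩
  have hnonneg : ∀ m : V →₀ ℕ, 0 ≤ coeff m ((∑ i, X i : MvPolynomial V ℝ) ^ r * f) := by
    intro m
    by_cases hm : m.degree = r + d
    · exact (hN₀ r hr m hm).le
    · have hhom : ((∑ i, X i : MvPolynomial V ℝ) ^ r * f).IsHomogeneous (r + d) := by
        have := ((isHomogeneous_sumX (Finset.univ : Finset V)).pow r).mul hf
        rwa [one_mul] at this
      rw [hhom.coeff_eq_zero hm]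
  have := isSumSq_sqLift_of_coeff_nonneg _ hnonneg
  rw [map_mul, map_pow, map_sum] at this
  simp only [sqLift_X] at this
  exact this

end EvenForms

/-! ## Matrix consequences: `C^{(r)}_n ⊆ K^{(r)}_n` and `int(COP_n) ⊆ ⋃_r K^{(r)}_n` -/

section Matrices

/-- The quadratic form polynomial of `MotzkinStrausCopositive` and of `ParriloCopositiveSos` agree.
[folklore] -/
@[folklore] private theorem quadPoly_eq_quadForm (M : Matrix V V ℝ) : quadPoly M = quadForm M := rfl

/-- **`C^{(r)}_n ⊆ K^{(r)}_n`** [cite: LaurentVargas2022, §1 ("C^{(r)}_n ⊆ K^{(r)}_n ⊆ COP_n")]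
[cite: Gvozdenovic2008, §4.2.1]: a Pólya (LP) certificate of order `r` yields a Parrilo (SOS)
certificate of the same order. -/
theorem inParriloCone_of_inPolyaCone {r : ℕ} {M : Matrix V V ℝ} (h : InPolyaCone r M) :
    InParriloCone r M :=
  inParriloCone_of_coeff_nonneg fun m => by rw [quadPoly_eq_quadForm]; exact h m

/-- **Strict copositivity implies membership in `K^{(r)}_n`, quantitatively**
[cite: Gvozdenovic2008, §4.2.1 (Thm 4.2.1 ⇒ Int 𝒞_n ⊆ ⋃_t K^{(t)}_n)] [cite: LaurentVargas2022, §1]: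
if `|M_{ij}| ≤ L` and `xᵀMx ≥ λ` on the simplex with `L < λ (r + 2)`, then `M ∈ K^{(r)}_n`. -/
theorem inParriloCone_of_strict (M : Matrix V V ℝ) {L lam : ℝ} (hL : ∀ i j, |M i j| ≤ L)
    (hlam : ∀ x ∈ stdSimplex ℝ V, lam ≤ x ⬝ᵥ M *ᵥ x) {r : ℕ} (hr : L < lam * (r + 2)) :
    InParriloCone r M :=
  inParriloCone_of_inPolyaCone (inPolyaCone_of_strict M hL hlam hr)

/-- `p_M` is a quadratic form. [folklore] -/
@[folklore] private theorem quadPoly_isHomogeneous (M : Matrix V V ℝ) : (quadPoly M).IsHomogeneous 2 := by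
  refine IsHomogeneous.sum _ _ _ fun i _ => IsHomogeneous.sum _ _ _ fun j _ => ?_
  have : (C (M i j) * X i * X j : MvPolynomial V ℝ).IsHomogeneous (0 + 1 + 1) :=
    ((isHomogeneous_C _ _).mul (isHomogeneous_X _ _)).mul (isHomogeneous_X _ _)
  exact this

/-- **`int(COP_n) ⊆ ⋃_r K^{(r)}_n`** [cite: Gvozdenovic2008, §4.2.1 ("Int 𝒞_n ⊆ ⋃_{t∈ℕ} K_n^{(t)}")]
[cite: Laurent2008, Thm 3.22]: a strictly copositive matrix (`xᵀMx > 0` on the simplex) lies in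
`K^{(r)}_n` for all large `r`. -/
theorem exists_inParriloCone_of_pos (M : Matrix V V ℝ) (hpos : ∀ x ∈ stdSimplex ℝ V, 0 < x ⬝ᵥ M *ᵥ x) :
    ∃ r₀ : ℕ, ∀ r : ℕ, r₀ ≤ r → InParriloCone r M := by
  obtain ⟨r₀, h⟩ := exists_isSumSq_sumSq_pow_mul_sqLift (quadPoly M) (quadPoly_isHomogeneous M)
    (fun x hx => by rw [eval_quadPoly]; exact hpos x hx)
  refine ⟨r₀, fun r hr => ?_⟩
  have := h r hr
  rwa [sqLift_quadPoly] at this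

/-- `P_{A+B} = P_A + P_B`. [folklore] -/
@[folklore] private theorem evenForm_add (A B : Matrix V V ℝ) :
    evenForm (A + B) = evenForm A + evenForm B := by
  simp only [evenForm, Matrix.add_apply, map_add, add_mul, Finset.sum_add_distrib]

/-- **`K^{(r)}_n` is a convex cone — closed under sums** [cite: Gvozdenovic2008, §4.2.1
("K^{(r)}_n … convex cones")] [cite: LaurentVargas2022, §1]. -/
theorem inParriloCone_add {r : ℕ} {A B : Matrix V V ℝ} (hA : InParriloCone r A) (hB : InParriloCone r B) :
    InParriloCone r (A + B) := by
  unfold InParriloCone at hA hB ⊢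
  rw [evenForm_add, mul_add]
  exact hA.add hB

end Matrices

/-! ## The parameters `ϑ^{(r)}(G)` -/

section Theta

variable [DecidableEq V] (G : SimpleGraph V) [DecidableRel G.Adj]

/-- **de Klerk–Pasechnik's semidefinite bound** `ϑ^{(r)}(G) = inf {t : t(I + A_G) - J ∈ K^{(r)}_n}`
[cite: LaurentVargas2022, §1 (ϑ^{(r)}(G))] [cite: Gvozdenovic2008, (4.37)]
[cite: Laurent2008, Example 3.24] [cite: DeklerkPasechnik2002, §4]. -/
def theta (r : ℕ) : ℝ := sInf {t : ℝ | InParriloCone r (dkpMatrix G t)}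

omit [Fintype V] in
/-- Entries of `t(I + A_G) - J`. [folklore] -/
@[folklore] private theorem dkpMatrix_apply (t : ℝ) (i j : V) :
    dkpMatrix G t i j = t * ((if i = j then 1 else 0) + if G.Adj i j then 1 else 0) - 1 := by
  simp only [dkpMatrix, msMatrix, onesMatrix, Matrix.sub_apply, Matrix.smul_apply, Matrix.add_apply,
    Matrix.one_apply, SimpleGraph.adjMatrix_apply, Matrix.of_apply, smul_eq_mul]

omit [Fintype V] in
/-- `t(I + A_G) - J` is symmetric. [folklore] -/
@[folklore] private theorem dkpMatrix_transpose (t : ℝ) : (dkpMatrix G t)ᵀ = dkpMatrix G t := by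
  have hJ : (onesMatrix : Matrix V V ℝ)ᵀ = onesMatrix := by ext; rfl
  rw [dkpMatrix, msMatrix, transpose_sub, transpose_smul, transpose_add, transpose_one,
    SimpleGraph.transpose_adjMatrix, hJ]

omit [DecidableEq V] in
/-- `xᵀ J x = (∑ xᵢ)²`. [folklore] -/
@[folklore] private theorem form_ones (x : V → ℝ) : x ⬝ᵥ onesMatrix *ᵥ x = (∑ i, x i) ^ 2 := by
  simp [onesMatrix, dotProduct, Matrix.mulVec, ← Finset.sum_mul, sq]

omit [DecidableEq V] in
/-- Block sums: `∑_c ∑_{i : C i = c} xᵢ = ∑ᵢ xᵢ`. [folklore] -/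
@[folklore] private theorem sum_blocks {k : ℕ} (C : V → Fin k) (x : V → ℝ) :
    ∑ c : Fin k, ∑ i, (if C i = c then x i else 0) = ∑ i, x i := by
  rw [Finset.sum_comm]
  exact Finset.sum_congr rfl fun i _ => by rw [Finset.sum_ite_eq]; simp

omit [DecidableEq V] in
/-- The quadratic form of the block matrix `B_{ij} = [C i = C j]` is `∑_c (∑_{i : C i = c} xᵢ)²`.
[folklore] -/
@[folklore] private theorem form_blocks {k : ℕ} (C : V → Fin k) (x : V → ℝ) :
    ∑ i, ∑ j, (if C i = C j then x i * x j else 0) =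
      ∑ c : Fin k, (∑ i, if C i = c then x i else 0) ^ 2 := by
  have hterm : ∀ i j, (if C i = C j then x i * x j else 0) =
      ∑ c : Fin k, (if C i = c then x i else 0) * (if C j = c then x j else 0) := fun i j => by
    have : ∀ c : Fin k, (if C i = c then x i else 0) * (if C j = c then x j else 0) =
        if C i = c then x i * (if C j = c then x j else 0) else 0 := fun c => by
      split_ifs <;> ring
    simp only [this, Finset.sum_ite_eq, Finset.mem_univ, if_true]
    by_cases h : C i = C j
    · rw [if_pos h, if_pos h.symm]
    · rw [if_neg h, if_neg (Ne.symm h), mul_zero]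
  simp only [hterm, sq, Finset.sum_mul_sum]
  symm
  rw [Finset.sum_comm]
  exact Finset.sum_congr rfl fun i _ => Finset.sum_comm

/-- **Clique covers certify `K^{(0)}`-membership**: if `V` is covered by `k` cliques of `G` (a proper
`k`-colouring `C` of the complement `Gᶜ`), then `k(I + A_G) - J = P + N` with
`P = k·[C i = C j] - J ⪰ 0` (Cauchy–Schwarz over the `k` blocks) and `N = k(I + A_G - [C i = C j]) ≥ 0`,
so `k(I + A_G) - J ∈ K^{(0)}_n`; this is the matrix fact behind `ϑ^{(0)}(G) = ϑ'(G) ≤ ϑ(G) ≤ χ(Ḡ)`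
[cite: LaurentVargas2022, §1 (1.5) ("α(G) ≤ ϑ'(G) ≤ ϑ(G) ≤ χ(Ḡ)") with Prop 3.7]. -/
theorem inParriloCone_zero_dkpMatrix_of_colorable {k : ℕ} (hc : Gᶜ.Colorable k) :
    InParriloCone 0 (dkpMatrix G k) := by
  classical
  obtain ⟨C⟩ := hc
  let B : Matrix V V ℝ := Matrix.of fun i j => if C i = C j then (1 : ℝ) else 0
  have hP : ((k : ℝ) • B - onesMatrix).PosSemidef := by
    refine PosSemidef.of_dotProduct_mulVec_nonneg ?_ fun x => ?_
    · ext i j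
      by_cases h : C i = C j
      · simp [B, onesMatrix, h]
      · simp [B, onesMatrix, h, Ne.symm h]
    · have hstar : star x = x := star_trivial x
      have hB : x ⬝ᵥ B *ᵥ x = ∑ i, ∑ j, (if C i = C j then x i * x j else 0) := by
        simp only [dotProduct, Matrix.mulVec, Matrix.of_apply, Finset.mul_sum, B]
        exact Finset.sum_congr rfl fun i _ => Finset.sum_congr rfl fun j _ => by
          split_ifs <;> ring
      rw [hstar, Matrix.sub_mulVec, dotProduct_sub, Matrix.smul_mulVec, dotProduct_smul,
        smul_eq_mul, hB, form_blocks, form_ones, ← sum_blocks C x, sub_nonneg]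
      have h := sq_sum_le_card_mul_sum_sq (s := (Finset.univ : Finset (Fin k)))
        (f := fun c => ∑ i, if C i = c then x i else 0)
      rwa [Finset.card_univ, Fintype.card_fin] at h
  have hN : ∀ i j, 0 ≤ ((k : ℝ) • (msMatrix G - B)) i j := by
    intro i j
    simp only [Matrix.smul_apply, Matrix.sub_apply, msMatrix, Matrix.add_apply, Matrix.one_apply,
      SimpleGraph.adjMatrix_apply, Matrix.of_apply, smul_eq_mul, B]
    refine mul_nonneg (Nat.cast_nonneg k) ?_
    by_cases hij : i = j
    · subst hij; simp
    · by_cases hC : C i = C j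
      · have hadj : G.Adj i j := by
          by_contra hG
          exact C.valid ((SimpleGraph.compl_adj G i j).2 ⟨hij, hG⟩) hC
        rw [if_neg hij, if_pos hadj, if_pos hC]; norm_num
      · rw [if_neg hC]; split_ifs <;> norm_num
  refine inParriloCone_zero_of_posSemidef_add_nonneg hP hN ?_
  ext i j
  simp only [dkpMatrix, Matrix.sub_apply, Matrix.smul_apply, Matrix.add_apply, smul_eq_mul]
  ring

/-- In particular (cover by singletons) `n(I + A_G) - J ∈ K^{(0)}_n`, so every level of the
hierarchy is feasible [cite: LaurentVargas2022, §1 ("ϑ^{(r)}(G) provides a nontrivial bound already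
at order r = 0")]. -/
theorem inParriloCone_dkpMatrix_card (r : ℕ) : InParriloCone r (dkpMatrix G (Fintype.card V)) :=
  (inParriloCone_zero_dkpMatrix_of_colorable G Gᶜ.selfColoring.colorable).mono (Nat.zero_le r)

/-- The feasible set of level `r` is nonempty. [folklore] -/
@[folklore] private theorem feasible_nonempty (r : ℕ) :
    {t : ℝ | InParriloCone r (dkpMatrix G t)}.Nonempty :=
  ⟨_, inParriloCone_dkpMatrix_card G r⟩

/-- **`K^{(r)}_n ⊆ COP_n` applied to `t(I + A_G) - J`**: a feasible `t` is at least `α(G)`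
[cite: LaurentVargas2022, §1 ("α(G) ≤ ϑ^{(r)}(G) ≤ ζ^{(r)}(G)")] [cite: DeklerkPasechnik2002, §4]. -/
theorem indepNum_le_of_inParriloCone_dkpMatrix [Nonempty V] {r : ℕ} {t : ℝ}
    (h : InParriloCone r (dkpMatrix G t)) : (G.indepNum : ℝ) ≤ t :=
  (isCopositive_dkpMatrix_iff G t).1 fun x hx => h.copositive x hx

/-- The feasible set of level `r` is bounded below by `α(G)`. [folklore] -/
@[folklore] private theorem feasible_bddBelow [Nonempty V] (r : ℕ) :
    BddBelow {t : ℝ | InParriloCone r (dkpMatrix G t)} :=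
  ⟨G.indepNum, fun _ ht => indepNum_le_of_inParriloCone_dkpMatrix G ht⟩

/-- `ϑ^{(r)}(G) ≤ t` for every feasible `t` [cite: LaurentVargas2022, §1 (ϑ^{(r)})]. -/
theorem theta_le_of_inParriloCone [Nonempty V] {r : ℕ} {t : ℝ}
    (h : InParriloCone r (dkpMatrix G t)) : theta G r ≤ t :=
  csInf_le (feasible_bddBelow G r) h

/-- **Feasibility is up-closed in `t`**: `K^{(r)}_n` is a convex cone containing the nonnegative
matrices, and `t'(I + A_G) - J = (t(I + A_G) - J) + (t' - t)(I + A_G)` [cite: LaurentVargas2022, §1]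
[cite: Gvozdenovic2008, §4.2.1]. -/
theorem inParriloCone_dkpMatrix_mono {r : ℕ} {t t' : ℝ} (h : InParriloCone r (dkpMatrix G t))
    (htt' : t ≤ t') : InParriloCone r (dkpMatrix G t') := by
  have hnn : ∀ i j, 0 ≤ ((t' - t) • msMatrix G) i j := fun i j => by
    simp only [Matrix.smul_apply, msMatrix, Matrix.add_apply, Matrix.one_apply,
      SimpleGraph.adjMatrix_apply, smul_eq_mul]
    refine mul_nonneg (sub_nonneg.2 htt') (add_nonneg ?_ ?_) <;> split_ifs <;> norm_num
  have hsum := inParriloCone_add h ((inParriloCone_zero_of_nonneg hnn).mono (Nat.zero_le r))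
  have heq : dkpMatrix G t + (t' - t) • msMatrix G = dkpMatrix G t' := by
    ext i j
    simp only [dkpMatrix, Matrix.add_apply, Matrix.sub_apply, Matrix.smul_apply, smul_eq_mul]
    ring
  rwa [heq] at hsum

/-- Every `t > ϑ^{(r)}(G)` is feasible at order `r` (the feasible region is a half-line)
[cite: LaurentVargas2022, §1 (ϑ^{(r)})]. -/
theorem inParriloCone_dkpMatrix_of_theta_lt [Nonempty V] {r : ℕ} {t : ℝ} (ht : theta G r < t) :
    InParriloCone r (dkpMatrix G t) := by
  obtain ⟨t₀, ht₀, hlt⟩ := (csInf_lt_iff (feasible_bddBelow G r) (feasible_nonempty G r)).1 ht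
  exact inParriloCone_dkpMatrix_mono G ht₀ hlt.le

/-- **`α(G) ≤ ϑ^{(r)}(G)`** [cite: LaurentVargas2022, §1 ("α(G) ≤ ϑ^{(r)}(G) ≤ ζ^{(r)}(G)")]
[cite: Gvozdenovic2008, §4.2.1 (4.37)] [cite: Laurent2008, Example 3.24]. -/
theorem indepNum_le_theta [Nonempty V] (r : ℕ) : (G.indepNum : ℝ) ≤ theta G r :=
  le_csInf (feasible_nonempty G r) fun _ ht => indepNum_le_of_inParriloCone_dkpMatrix G ht

/-- **`ϑ^{(r)}(G) ≤ ζ^{(r)}(G)`** (for the levels `r ≥ α(G) - 1` where the LP bound is finite)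
[cite: LaurentVargas2022, §1 ("α(G) ≤ ϑ^{(r)}(G) ≤ ζ^{(r)}(G)")]. -/
theorem theta_le_zeta [Nonempty V] {r : ℕ} (hr : G.indepNum ≤ r + 1) : theta G r ≤ zeta G r :=
  theta_le_of_inParriloCone G (inParriloCone_of_inPolyaCone (inPolyaCone_dkpMatrix_zeta G hr))

/-- `ϑ^{(r)}(G) ≤ n` [cite: LaurentVargas2022, §1]. -/
theorem theta_le_card [Nonempty V] (r : ℕ) : theta G r ≤ Fintype.card V :=
  theta_le_of_inParriloCone G (inParriloCone_dkpMatrix_card G r)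

/-- **The hierarchy is monotone**: `ϑ^{(s)}(G) ≤ ϑ^{(r)}(G)` for `r ≤ s`, since `K^{(r)} ⊆ K^{(s)}`
[cite: Gvozdenovic2008, §4.2.1 ("K^{(0)} ⊆ ⋯ ⊆ K^{(t)} ⊆ K^{(t+1)} ⊆ ⋯")] [cite: LaurentVargas2022, §1]. -/
theorem theta_anti [Nonempty V] {r s : ℕ} (hrs : r ≤ s) : theta G s ≤ theta G r :=
  csInf_le_csInf (feasible_bddBelow G s) (feasible_nonempty G r) fun _ ht => InParriloCone.mono hrs ht

/-- **Finite convergence after rounding** [cite: Gvozdenovic2008, Thm 4.2.10]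
[cite: LaurentVargas2022, §1 ("one can find α(G), after rounding, in α(G)² steps")]
[cite: DeklerkPasechnik2002, §4]: `⌊ϑ^{(r)}(G)⌋ = α(G)` as soon as `r ≥ α(G)² - 1`
(from `α ≤ ϑ^{(r)} ≤ ζ^{(r)} < α + 1`). -/
theorem floor_theta_eq_indepNum [Nonempty V] {r : ℕ} (hr : G.indepNum ^ 2 ≤ r + 1) :
    ⌊theta G r⌋₊ = G.indepNum := by
  have hαr : G.indepNum ≤ r + 1 := le_trans (Nat.le_self_pow two_ne_zero _) hr
  have h1 := indepNum_le_theta G r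
  have h2 := theta_le_zeta G hαr
  have h0 : (0 : ℝ) ≤ theta G r := le_trans (Nat.cast_nonneg _) h1
  have hz := ((Nat.floor_eq_iff (h0.trans h2)).1 (floor_zeta_eq_indepNum G hr)).2
  rw [Nat.floor_eq_iff h0]
  exact ⟨h1, lt_of_le_of_lt h2 hz⟩

/-- **`ϑ^{(r)}(G) ≤ χ(Ḡ)`**: a cover of `V` by `k` cliques bounds every level
[cite: LaurentVargas2022, §1 (1.5) with ϑ^{(0)} = ϑ']. -/
theorem theta_le_of_colorable [Nonempty V] {k : ℕ} (hc : Gᶜ.Colorable k) (r : ℕ) :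
    theta G r ≤ k :=
  theta_le_of_inParriloCone G ((inParriloCone_zero_dkpMatrix_of_colorable G hc).mono (Nat.zero_le r))

/-- **Rank zero when `α(G) = χ(Ḡ)`** [cite: LaurentVargas2022, §1 ("if α(G) = χ(Ḡ) then
ϑ^{(0)}(G) = α(G) … this holds, e.g., for perfect graphs")]: if `V` is covered by `α(G)` cliques
then `ϑ^{(r)}(G) = α(G)` for every `r`, in particular `ϑ^{(0)}(G) = α(G)`. -/
theorem theta_eq_indepNum_of_colorable [Nonempty V] (hc : Gᶜ.Colorable G.indepNum) (r : ℕ) :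
    theta G r = G.indepNum :=
  le_antisymm (theta_le_of_colorable G hc r) (indepNum_le_theta G r)

end Theta

/-! ## The 5-cycle: the order-0 certificate fails at `t = α(C₅) = 2` -/

section FiveCycle

open SimpleGraph

/-- Kernel trick for `P ⪰ 0`: if `P_ii = P_jj = 1` and `P_ij ≤ -1` then `P_ij = -1`,
`(e_i + e_j)ᵀ P (e_i + e_j) = 0`, hence `P(e_i + e_j) = 0`. [folklore] -/
@[folklore] private theorem col_add_col_eq_zero {n : Type*} [Fintype n] [DecidableEq n]
    {P : Matrix n n ℝ} (hP : P.PosSemidef) {i j : n} (hii : P i i = 1) (hjj : P j j = 1)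
    (hij : P i j ≤ -1) (k : n) : P k i + P k j = 0 := by
  have hsymm : P j i = P i j := by simpa using hP.1.apply i j
  set x : n → ℝ := Pi.single i 1 + Pi.single j 1 with hx
  have hPx : P *ᵥ x = fun k => P k i + P k j := by
    rw [hx, Matrix.mulVec_add, Matrix.mulVec_single_one, Matrix.mulVec_single_one]; rfl
  have hform : star x ⬝ᵥ P *ᵥ x = P i i + P i j + (P j i + P j j) := by
    rw [star_trivial, hPx, hx, add_dotProduct, single_dotProduct, single_dotProduct, one_mul, one_mul]
  have hnonneg : 0 ≤ star x ⬝ᵥ P *ᵥ x := hP.dotProduct_mulVec_nonneg x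
  have hPij : P i j = -1 := by
    rw [hform, hsymm, hii, hjj] at hnonneg
    exact le_antisymm hij (by linarith)
  have hzero : star x ⬝ᵥ P *ᵥ x = 0 := by
    rw [hform, hsymm, hii, hjj, hPij]; norm_num
  have hPx0 := (hP.dotProduct_mulVec_zero_iff x).1 hzero
  rw [hPx] at hPx0
  exact congrFun hPx0 k

/-- **The 5-cycle has `ϑ`-rank `≥ 1` at the level of certificates**: for `G = C₅` and
`t = α(C₅) = 2` the matrix `2(I + A_{C₅}) - J` — the Horn matrix, with `-1` exactly on the
pentagram `C̄₅` — is *not* of the form `P + N` (`P ⪰ 0`, `N ≥ 0`), i.e. it is not in `K^{(0)}_5`: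
its Parrilo form `∑_{ij} M_{ij} x_i² x_j²` is not a sum of squares although `M` is copositive
[cite: Laurent2008, Example 3.23 ("while p_M is not a SOS", after Parrilo)]
[cite: LaurentVargas2022, §1 ("the cycle C_5 has α(C_5) = 2 and ϑ-rank(C_5) = 1")].
Proof: `P_ii = 1` and `P_ij ≤ -1` on the pentagram force `P e_i = -P e_j` around an odd cycle. -/
theorem not_inParriloCone_zero_dkpMatrix_cycleGraph_five :
    ¬ InParriloCone 0 (dkpMatrix (cycleGraph 5) 2) := by
  intro h
  obtain ⟨P, N, hP, hN, hNd, hM⟩ :=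
    exists_posSemidef_add_nonneg_of_inParriloCone_zero (dkpMatrix_transpose (cycleGraph 5) 2) h
  have hent : ∀ i j : Fin 5, P i j + N i j =
      2 * ((if i = j then 1 else 0) + if (cycleGraph 5).Adj i j then 1 else 0) - 1 := fun i j => by
    rw [← dkpMatrix_apply (cycleGraph 5) 2 i j, hM, Matrix.add_apply]
  have hdiag : ∀ i : Fin 5, P i i = 1 := fun i => by
    have := hent i i
    rw [if_pos rfl, if_neg ((cycleGraph 5).irrefl), hNd] at this
    linarith
  have hoff : ∀ i j : Fin 5, i ≠ j → ¬ (cycleGraph 5).Adj i j → P i j ≤ -1 := fun i j hij hadj => by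
    have := hent i j
    rw [if_neg hij, if_neg hadj] at this
    linarith [hN i j]
  have hker : ∀ i j : Fin 5, i ≠ j → ¬ (cycleGraph 5).Adj i j → P 0 i + P 0 j = 0 :=
    fun i j hij hadj => col_add_col_eq_zero hP (hdiag i) (hdiag j) (hoff i j hij hadj) 0
  have h02 := hker 0 2 (by decide) (by decide)
  have h24 := hker 2 4 (by decide) (by decide)
  have h41 := hker 4 1 (by decide) (by decide)
  have h13 := hker 1 3 (by decide) (by decide)
  have h30 := hker 3 0 (by decide) (by decide)
  linarith [hdiag 0]

end FiveCycle

end Literature.Combinatorics.Optimization.DeKlerkPasechnikTheta
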